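import Summits.BirchSwinnertonDyer.Rank2.LevelFifteenManinSymbols
import HarnessLib

/-!
# Manin symbols on `Γ₀(15)`, II: Euclid descent over `SL(2, ℤ)` and the period law
# `{∞, γ∞}_h = n₁E₁(h) + n₂E₂(h)`, `n₁ ≡ [(d/5) = −1] (mod 2)` for every `γ = (a b; c d) ∈ Γ₀(15)`

Cell `bsd-rank2` (D-0036), seat `bsd-rank2-eng` GEN 8 (director-bsd g8, 2026-08-27T09:39:43Z). For every
`h ∈ S₂(Γ₀(15))` and every `k = (a b; c d) ∈ SL(2, ℤ)`:
`{∞, k∞}_h = W_{cls(c,d)}(h) + n₁E₁(h) + n₂E₂(h)` with `n₁ ≡ sgn(c, d) (mod 2)` (`inftySymbol_decomp`), where `cls`,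
`sgn` are the class / sign tables of the bottom row modulo `15` (`LevelFifteenManinTablesDefs`) — by Euclid descent on
`|c|` through the moves `k ↦ kT^{±1}` (`{∞, kT∞} = {∞, k∞}`) and `k ↦ kS` (`{∞, kS∞} = {∞, k∞} − [k]`), each move
being one of the 48 certified identities of `LevelFifteenManinSymbols` plus a `decide`d table fact. Consequences:

* `cuspSymbol_decomp` — **for `γ ∈ Γ₀(15)`: `{∞, γ∞}_h = n₁E₁ + n₂E₂` with `2 ∣ n₁ ↔ d² ≡ 1 (mod 5)`** (lit GEN 16's
  level-15 LAW «ω₁-coordinate odd ⟺ (d/5) = −1», here a theorem for all of `Γ₀(15)` and every cusp form of level 15);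
* `cuspSymbol_gamma0_eq_E₁` — `{∞, γ₀∞}_h = E₁(h)` for `γ₀ = (8 1; 15 2)` (so `E₁ ∈ Λ_h`).

THEOREMS ONLY; no `sorry`; standard axioms. PARTITION: none — r_an ≥ 2, summit axis S0; TWIN (D-0056): n/a. B1 honesty:
linear algebra of M-symbols at level 15; no S0 motion.

References: Ju. I. Manin, *Izv. Akad. Nauk SSSR* 36 (1972) Thm. 1.6, Thm. 1.9 [Manin1972]; J. E. Cremona, *Algorithms for
modular elliptic curves* (1997) §2.2–§2.3 [CremonaAlgorithms1997].
-/

noncomputable section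

open scoped MatrixGroups ModularForm

open CongruenceSubgroup Matrix.SpecialLinearGroup ModularGroup
open Literature.NumberTheory.EllipticCurves.ModularForms

namespace Summit.BirchSwinnertonDyer.Rank2.LevelFifteen

/-! ### §1 Admissible residue pairs and the table facts (`decide`) -/

/-- `T`-move table fact (over `Fin 15 = ℤ/15`): class and sign of `(c, c + d)`. [folklore] -/
theorem tab_T : ∀ c d : Fin 15, ¬ (c.val % 3 = 0 ∧ d.val % 3 = 0) → ¬ (c.val % 5 = 0 ∧ d.val % 5 = 0) →
    clsTab c (c + d) = tIdx (clsTab c d) ∧ (sgnTab c (c + d) - sgnTab c d - tA1 (clsTab c d)) % 2 = 0 := by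
  decide

/-- `S`-move table fact: class and sign of `(d, −c)`. [folklore] -/
theorem tab_S : ∀ c d : Fin 15, ¬ (c.val % 3 = 0 ∧ d.val % 3 = 0) → ¬ (c.val % 5 = 0 ∧ d.val % 5 = 0) →
    clsTab d (-c) = sIdx (clsTab c d) ∧ (sgnTab d (-c) - sgnTab c d - sA1 (clsTab c d)) % 2 = 0 := by
  decide

/-- The representative of the class of `(c, d)` has bottom row proportional to `(c, d)` mod `15`. [folklore] -/
theorem tab_rep : ∀ c d : Fin 15, ¬ (c.val % 3 = 0 ∧ d.val % 3 = 0) → ¬ (c.val % 5 = 0 ∧ d.val % 5 = 0) →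
    ((c.val : ℤ) * repD (clsTab c d) - (d.val : ℤ) * repC (clsTab c d)) % 15 = 0 := by
  decide

/-- Base table fact: the class of `(0, ±1)` is `0`, its sign is `0`, and the chain of class `0` is empty. [folklore] -/
theorem tab_base : clsTab ((0 : ℤ) : ZMod 15) ((1 : ℤ) : ZMod 15) = 0 ∧ clsTab ((0 : ℤ) : ZMod 15) ((-1 : ℤ) : ZMod 15) = 0 ∧
    sgnTab ((0 : ℤ) : ZMod 15) ((1 : ℤ) : ZMod 15) = 0 ∧ sgnTab ((0 : ℤ) : ZMod 15) ((-1 : ℤ) : ZMod 15) = 0 ∧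
    ∀ i, chainTab 0 i = 0 := by
  refine ⟨by decide, by decide, by decide, by decide, by decide⟩

/-- `Γ₀(15)` table fact: for `c ≡ 0`, the class is `0` and the sign is `[d² ≢ 1 (mod 5)]`. [folklore] -/
theorem tab_gamma0 : ∀ d : Fin 15, ¬ ((0 : Fin 15).val % 3 = 0 ∧ d.val % 3 = 0) →
    ¬ ((0 : Fin 15).val % 5 = 0 ∧ d.val % 5 = 0) →
    clsTab 0 d = 0 ∧ ((sgnTab 0 d = 0 ∧ d.val ^ 2 % 5 = 1) ∨ (sgnTab 0 d = 1 ∧ d.val ^ 2 % 5 ≠ 1)) := by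
  decide

/-- Reduction modulo `3` through `ℤ/15`: `((x : ℤ/15).val : ℤ/3) = x`. [folklore] -/
theorem val_cast_zmod_three (x : ℤ) : (((x : ZMod 15)).val : ZMod 3) = (x : ZMod 3) := by
  have h := map_intCast (ZMod.castHom (show 3 ∣ 15 by norm_num) (ZMod 3)) x
  rw [ZMod.castHom_apply, ZMod.cast_eq_val] at h
  exact h

/-- Reduction modulo `5` through `ℤ/15`: `((x : ℤ/15).val : ℤ/5) = x`. [folklore] -/
theorem val_cast_zmod_five (x : ℤ) : (((x : ZMod 15)).val : ZMod 5) = (x : ZMod 5) := by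
  have h := map_intCast (ZMod.castHom (show 5 ∣ 15 by norm_num) (ZMod 5)) x
  rw [ZMod.castHom_apply, ZMod.cast_eq_val] at h
  exact h

/-- The bottom row of `k ∈ SL(2, ℤ)` is admissible at `3`. [folklore] -/
theorem adm_three (k : SL(2, ℤ)) :
    ¬ (((k 1 0 : ℤ) : ZMod 15).val % 3 = 0 ∧ ((k 1 1 : ℤ) : ZMod 15).val % 3 = 0) := by
  rintro ⟨hc, hd⟩
  have hc' : ((k 1 0 : ℤ) : ZMod 3) = 0 := by
    rw [← val_cast_zmod_three, ZMod.natCast_eq_zero_iff]; exact Nat.dvd_of_mod_eq_zero hc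
  have hd' : ((k 1 1 : ℤ) : ZMod 3) = 0 := by
    rw [← val_cast_zmod_three, ZMod.natCast_eq_zero_iff]; exact Nat.dvd_of_mod_eq_zero hd
  have hdet := Matrix.SpecialLinearGroup.det_coe k
  rw [Matrix.det_fin_two] at hdet
  have := congrArg (fun z : ℤ ↦ (z : ZMod 3)) hdet
  simp only [Int.cast_sub, Int.cast_mul, Int.cast_one, hc', hd', mul_zero, sub_zero] at this
  revert this; decide

/-- The bottom row of `k ∈ SL(2, ℤ)` is admissible at `5`. [folklore] -/
theorem adm_five (k : SL(2, ℤ)) :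
    ¬ (((k 1 0 : ℤ) : ZMod 15).val % 5 = 0 ∧ ((k 1 1 : ℤ) : ZMod 15).val % 5 = 0) := by
  rintro ⟨hc, hd⟩
  have hc' : ((k 1 0 : ℤ) : ZMod 5) = 0 := by
    rw [← val_cast_zmod_five, ZMod.natCast_eq_zero_iff]; exact Nat.dvd_of_mod_eq_zero hc
  have hd' : ((k 1 1 : ℤ) : ZMod 5) = 0 := by
    rw [← val_cast_zmod_five, ZMod.natCast_eq_zero_iff]; exact Nat.dvd_of_mod_eq_zero hd
  have hdet := Matrix.SpecialLinearGroup.det_coe k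
  rw [Matrix.det_fin_two] at hdet
  have := congrArg (fun z : ℤ ↦ (z : ZMod 5)) hdet
  simp only [Int.cast_sub, Int.cast_mul, Int.cast_one, hc', hd', mul_zero, sub_zero] at this
  revert this; decide

/-- `T`-move table fact in integer form (the `ℤ/15`-addition is definitionally `Fin 15`-addition). [folklore] -/
theorem tab_T_int (a b : ℤ) (h3 : ¬ (((a : ZMod 15)).val % 3 = 0 ∧ ((b : ZMod 15)).val % 3 = 0))
    (h5 : ¬ (((a : ZMod 15)).val % 5 = 0 ∧ ((b : ZMod 15)).val % 5 = 0)) :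
    clsTab (a : ZMod 15) ((a + b : ℤ) : ZMod 15) = tIdx (clsTab (a : ZMod 15) (b : ZMod 15)) ∧
      (sgnTab (a : ZMod 15) ((a + b : ℤ) : ZMod 15) - sgnTab (a : ZMod 15) (b : ZMod 15) -
        tA1 (clsTab (a : ZMod 15) (b : ZMod 15))) % 2 = 0 := by
  rw [Int.cast_add]; exact tab_T _ _ h3 h5

/-- `S`-move table fact in integer form. [folklore] -/
theorem tab_S_int (a b : ℤ) (h3 : ¬ (((a : ZMod 15)).val % 3 = 0 ∧ ((b : ZMod 15)).val % 3 = 0))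
    (h5 : ¬ (((a : ZMod 15)).val % 5 = 0 ∧ ((b : ZMod 15)).val % 5 = 0)) :
    clsTab (b : ZMod 15) ((-a : ℤ) : ZMod 15) = sIdx (clsTab (a : ZMod 15) (b : ZMod 15)) ∧
      (sgnTab (b : ZMod 15) ((-a : ℤ) : ZMod 15) - sgnTab (a : ZMod 15) (b : ZMod 15) -
        sA1 (clsTab (a : ZMod 15) (b : ZMod 15))) % 2 = 0 := by
  rw [Int.cast_neg]; exact tab_S _ _ h3 h5

/-- The representative fact in integer form: `15 ∣ a·d_P − b·c_P` for `P = cls(a, b)`. [folklore] -/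
theorem tab_rep_int (a b : ℤ) (h3 : ¬ (((a : ZMod 15)).val % 3 = 0 ∧ ((b : ZMod 15)).val % 3 = 0))
    (h5 : ¬ (((a : ZMod 15)).val % 5 = 0 ∧ ((b : ZMod 15)).val % 5 = 0)) :
    (15 : ℤ) ∣ a * repD (clsTab (a : ZMod 15) (b : ZMod 15)) - b * repC (clsTab (a : ZMod 15) (b : ZMod 15)) := by
  set P := clsTab (a : ZMod 15) (b : ZMod 15) with hP
  have ht : ((((a : ZMod 15)).val : ℤ) * repD P - (((b : ZMod 15)).val : ℤ) * repC P) % 15 = 0 :=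
    tab_rep _ _ h3 h5
  rw [ZMod.val_intCast, ZMod.val_intCast] at ht
  simp only [Nat.cast_ofNat] at ht
  have hmod : a % 15 * repD P - b % 15 * repC P ≡ a * repD P - b * repC P [ZMOD 15] :=
    ((Int.mod_modEq _ _).mul_right _).sub ((Int.mod_modEq _ _).mul_right _)
  rw [Int.ModEq, ht] at hmod
  exact Int.dvd_of_emod_eq_zero hmod.symm

/-- `Γ₀(15)` table fact in integer form. [folklore] -/
theorem tab_gamma0_int (b : ℤ) (h3 : ¬ ((((0 : ℤ) : ZMod 15)).val % 3 = 0 ∧ ((b : ZMod 15)).val % 3 = 0))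
    (h5 : ¬ ((((0 : ℤ) : ZMod 15)).val % 5 = 0 ∧ ((b : ZMod 15)).val % 5 = 0)) :
    clsTab ((0 : ℤ) : ZMod 15) (b : ZMod 15) = 0 ∧
      ((sgnTab ((0 : ℤ) : ZMod 15) (b : ZMod 15) = 0 ∧ ((b : ZMod 15)).val ^ 2 % 5 = 1) ∨
        (sgnTab ((0 : ℤ) : ZMod 15) (b : ZMod 15) = 1 ∧ ((b : ZMod 15)).val ^ 2 % 5 ≠ 1)) := by
  rw [Int.cast_zero] at h3 h5 ⊢; exact tab_gamma0 _ h3 h5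

variable (h : CuspForm (Gamma0 15) 2)

/-- **`[k]_h = x_{cls(c,d)}(h)`**: the M-symbol of any `k ∈ SL(2, ℤ)` is the value of the class of its bottom row.
[cite: CremonaAlgorithms1997, §2.2 Prop. 2.2.2] -/
theorem msymbolSL_eq_xval (k : SL(2, ℤ)) :
    msymbolSL h k = xval h (clsTab ((k 1 0 : ℤ) : ZMod 15) ((k 1 1 : ℤ) : ZMod 15)) :=
  msymbolSL_eq_of_row h (by
    rw [rep_apply_10, rep_apply_11]; exact tab_rep_int _ _ (adm_three k) (adm_five k))

/-! ### §2 The moves -/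

/-- `T`-move: the claim for `k` gives the claim for `kT`. [cite: Manin1972, Thm. 1.6] -/
theorem claim_mul_T {k : SL(2, ℤ)}
    (hk : ∃ n₁ n₂ : ℤ, inftySymbol h k =
        W h (clsTab ((k 1 0 : ℤ) : ZMod 15) ((k 1 1 : ℤ) : ZMod 15)) + n₁ * E₁ h + n₂ * E₂ h ∧
      (2 : ℤ) ∣ n₁ - sgnTab ((k 1 0 : ℤ) : ZMod 15) ((k 1 1 : ℤ) : ZMod 15)) :
    ∃ n₁ n₂ : ℤ, inftySymbol h (k * T) =
        W h (clsTab (((k * T) 1 0 : ℤ) : ZMod 15) (((k * T) 1 1 : ℤ) : ZMod 15)) + n₁ * E₁ h + n₂ * E₂ h ∧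
      (2 : ℤ) ∣ n₁ - sgnTab (((k * T) 1 0 : ℤ) : ZMod 15) (((k * T) 1 1 : ℤ) : ZMod 15) := by
  obtain ⟨n₁, n₂, hval, hpar⟩ := hk
  have h10 : (k * T) 1 0 = k 1 0 := by simp [coe_T, Matrix.mul_apply, Fin.sum_univ_two]
  have h11 : (k * T) 1 1 = k 1 0 + k 1 1 := by simp [coe_T, Matrix.mul_apply, Fin.sum_univ_two]
  obtain ⟨hcls, hsgn⟩ := tab_T_int (k 1 0) (k 1 1) (adm_three k) (adm_five k)
  set P := clsTab ((k 1 0 : ℤ) : ZMod 15) ((k 1 1 : ℤ) : ZMod 15) with hP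
  have hW := W_sub_W_tIdx h P
  refine ⟨n₁ + tA1 P, n₂ + tA2 P, ?_, ?_⟩
  · rw [inftySymbol_mul_T, h10, h11, hcls, hval]; push_cast
    linear_combination hW
  · rw [h10, h11]
    obtain ⟨u, hu⟩ := hpar; obtain ⟨v, hv⟩ := Int.dvd_of_emod_eq_zero hsgn
    exact ⟨u - v, by linear_combination hu - hv⟩

/-- `T`-move, converse: the claim for `kT` gives the claim for `k`. [cite: Manin1972, Thm. 1.6] -/
theorem claim_of_mul_T {k : SL(2, ℤ)}
    (hk : ∃ n₁ n₂ : ℤ, inftySymbol h (k * T) =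
        W h (clsTab (((k * T) 1 0 : ℤ) : ZMod 15) (((k * T) 1 1 : ℤ) : ZMod 15)) + n₁ * E₁ h + n₂ * E₂ h ∧
      (2 : ℤ) ∣ n₁ - sgnTab (((k * T) 1 0 : ℤ) : ZMod 15) (((k * T) 1 1 : ℤ) : ZMod 15)) :
    ∃ n₁ n₂ : ℤ, inftySymbol h k =
        W h (clsTab ((k 1 0 : ℤ) : ZMod 15) ((k 1 1 : ℤ) : ZMod 15)) + n₁ * E₁ h + n₂ * E₂ h ∧
      (2 : ℤ) ∣ n₁ - sgnTab ((k 1 0 : ℤ) : ZMod 15) ((k 1 1 : ℤ) : ZMod 15) := by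
  obtain ⟨n₁, n₂, hval, hpar⟩ := hk
  have h10 : (k * T) 1 0 = k 1 0 := by simp [coe_T, Matrix.mul_apply, Fin.sum_univ_two]
  have h11 : (k * T) 1 1 = k 1 0 + k 1 1 := by simp [coe_T, Matrix.mul_apply, Fin.sum_univ_two]
  obtain ⟨hcls, hsgn⟩ := tab_T_int (k 1 0) (k 1 1) (adm_three k) (adm_five k)
  set P := clsTab ((k 1 0 : ℤ) : ZMod 15) ((k 1 1 : ℤ) : ZMod 15) with hP
  have hW := W_sub_W_tIdx h P
  rw [inftySymbol_mul_T, h10, h11, hcls] at hval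
  rw [h10, h11] at hpar
  refine ⟨n₁ - tA1 P, n₂ - tA2 P, ?_, ?_⟩
  · rw [hval]; push_cast; linear_combination -hW
  · obtain ⟨u, hu⟩ := hpar; obtain ⟨v, hv⟩ := Int.dvd_of_emod_eq_zero hsgn
    exact ⟨u + v, by linear_combination hu + hv⟩

/-- `T^q`-move, converse direction, for every integer power. [cite: Manin1972, Thm. 1.6] -/
theorem claim_of_mul_T_zpow (q : ℤ) : ∀ {k : SL(2, ℤ)},
    (∃ n₁ n₂ : ℤ, inftySymbol h (k * T ^ q) =
        W h (clsTab (((k * T ^ q) 1 0 : ℤ) : ZMod 15) (((k * T ^ q) 1 1 : ℤ) : ZMod 15)) + n₁ * E₁ h + n₂ * E₂ h ∧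
      (2 : ℤ) ∣ n₁ - sgnTab (((k * T ^ q) 1 0 : ℤ) : ZMod 15) (((k * T ^ q) 1 1 : ℤ) : ZMod 15)) →
    ∃ n₁ n₂ : ℤ, inftySymbol h k =
        W h (clsTab ((k 1 0 : ℤ) : ZMod 15) ((k 1 1 : ℤ) : ZMod 15)) + n₁ * E₁ h + n₂ * E₂ h ∧
      (2 : ℤ) ∣ n₁ - sgnTab ((k 1 0 : ℤ) : ZMod 15) ((k 1 1 : ℤ) : ZMod 15) := by
  induction q using Int.induction_on with
  | zero => intro k hk; simpa using hk
  | succ n ih =>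
    intro k hk
    refine ih ?_
    rw [zpow_add_one, ← mul_assoc] at hk
    exact claim_of_mul_T h hk
  | pred n ih =>
    intro k hk
    have e : k * T ^ (-(n : ℤ)) = k * T ^ (-(n : ℤ) - 1) * T := by
      rw [mul_assoc, ← zpow_add_one, sub_add_cancel]
    apply ih
    rw [e]
    exact claim_mul_T h hk

/-- `S`-move, converse: the claim for `kS` gives the claim for `k` (`{∞, kS∞} = {∞, k∞} − [k]`).
[cite: Manin1972, Thm. 1.6] -/
theorem claim_of_mul_S {k : SL(2, ℤ)}
    (hk : ∃ n₁ n₂ : ℤ, inftySymbol h (k * S) =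
        W h (clsTab (((k * S) 1 0 : ℤ) : ZMod 15) (((k * S) 1 1 : ℤ) : ZMod 15)) + n₁ * E₁ h + n₂ * E₂ h ∧
      (2 : ℤ) ∣ n₁ - sgnTab (((k * S) 1 0 : ℤ) : ZMod 15) (((k * S) 1 1 : ℤ) : ZMod 15)) :
    ∃ n₁ n₂ : ℤ, inftySymbol h k =
        W h (clsTab ((k 1 0 : ℤ) : ZMod 15) ((k 1 1 : ℤ) : ZMod 15)) + n₁ * E₁ h + n₂ * E₂ h ∧
      (2 : ℤ) ∣ n₁ - sgnTab ((k 1 0 : ℤ) : ZMod 15) ((k 1 1 : ℤ) : ZMod 15) := by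
  obtain ⟨n₁, n₂, hval, hpar⟩ := hk
  rw [mul_S_apply_10, mul_S_apply_11] at hval hpar
  obtain ⟨hcls, hsgn⟩ := tab_S_int (k 1 0) (k 1 1) (adm_three k) (adm_five k)
  set P := clsTab ((k 1 0 : ℤ) : ZMod 15) ((k 1 1 : ℤ) : ZMod 15) with hP
  have hW := W_sub_xval_sub_W_sIdx h P
  have hM : msymbolSL h k = xval h P := msymbolSL_eq_xval h k
  have hdef : inftySymbol h k = msymbolSL h k + inftySymbol h (k * S) := by rw [msymbolSL]; ring
  rw [hcls] at hval
  refine ⟨n₁ - sA1 P, n₂ - sA2 P, ?_, ?_⟩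
  · rw [hdef, hM, hval]; push_cast; linear_combination -hW
  · obtain ⟨u, hu⟩ := hpar; obtain ⟨v, hv⟩ := Int.dvd_of_emod_eq_zero hsgn
    exact ⟨u + v, by linear_combination hu + hv⟩

/-! ### §3 The descent -/

/-- **Every `{∞, k∞}_h` decomposes**: `{∞, k∞}_h = W_{cls(c,d)}(h) + n₁E₁(h) + n₂E₂(h)`, `n₁ ≡ sgn(c,d) (mod 2)`,
for every `k = (a b; c d) ∈ SL(2, ℤ)` (Euclid on `(c, d)`: `k ↦ kT^{−q}S` lowers `|c|`). [cite: Manin1972, Thm. 1.6] -/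
theorem inftySymbol_decomp (k : SL(2, ℤ)) :
    ∃ n₁ n₂ : ℤ, inftySymbol h k =
        W h (clsTab ((k 1 0 : ℤ) : ZMod 15) ((k 1 1 : ℤ) : ZMod 15)) + n₁ * E₁ h + n₂ * E₂ h ∧
      (2 : ℤ) ∣ n₁ - sgnTab ((k 1 0 : ℤ) : ZMod 15) ((k 1 1 : ℤ) : ZMod 15) := by
  suffices H : ∀ (n : ℕ) (k : SL(2, ℤ)), (k 1 0).natAbs ≤ n →
      ∃ n₁ n₂ : ℤ, inftySymbol h k =
          W h (clsTab ((k 1 0 : ℤ) : ZMod 15) ((k 1 1 : ℤ) : ZMod 15)) + n₁ * E₁ h + n₂ * E₂ h ∧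
        (2 : ℤ) ∣ n₁ - sgnTab ((k 1 0 : ℤ) : ZMod 15) ((k 1 1 : ℤ) : ZMod 15) from H _ k le_rfl
  intro n
  induction n with
  | zero =>
    intro k hk
    have hc : k 1 0 = 0 := Int.natAbs_eq_zero.mp (Nat.le_zero.mp hk)
    -- then `k = ±T^b`: `a d = 1`
    have hdet := Matrix.SpecialLinearGroup.det_coe k
    rw [Matrix.det_fin_two, hc, mul_zero, sub_zero] at hdet
    have hinf : inftySymbol h k = 0 := by simp [inftySymbol, hc]
    obtain ⟨h01, h0m1, hs1, hsm1, hchain⟩ := tab_base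
    have hW0 : W h 0 = 0 := by
      unfold W ev; exact Finset.sum_eq_zero fun i _ ↦ by rw [hchain i]; simp
    rcases Int.eq_one_or_neg_one_of_mul_eq_one' hdet with ⟨-, hd⟩ | ⟨-, hd⟩
    · refine ⟨0, 0, ?_, ?_⟩
      · rw [hinf, hc, hd, h01, hW0]; simp
      · rw [hc, hd, hs1]; simp
    · refine ⟨0, 0, ?_, ?_⟩
      · rw [hinf, hc, hd, h0m1, hW0]; simp
      · rw [hc, hd, hsm1]; simp
  | succ n ih =>
    intro k hk
    by_cases hle : (k 1 0).natAbs ≤ n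
    · exact ih k hle
    have hcn : (k 1 0).natAbs = n + 1 := by omega
    have hc0 : k 1 0 ≠ 0 := by
      intro h0; rw [h0] at hcn; simp at hcn
    -- Euclid: `d = q c + r` with `|r| < |c|`; move to `k' = k T^{-q} S`, bottom row `(r, -c)`... we need `|r| ≤ n`
    set c : ℤ := k 1 0 with hcdef
    set d : ℤ := k 1 1 with hddef
    set q : ℤ := d / c with hq
    set r : ℤ := d % c with hr
    have hrd : d = q * c + r := by
      have := Int.emod_add_mul_ediv d c
      rw [hq, hr]; linarith
    have hr_lt : r.natAbs ≤ n := by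
      have h1 : 0 ≤ r := Int.emod_nonneg d hc0
      have h2 : r < |c| := Int.emod_lt_abs d hc0
      have : r.natAbs < c.natAbs := by
        rw [← Int.ofNat_lt]; rw [Int.natAbs_of_nonneg h1, ← Int.abs_eq_natAbs]; exact h2
      omega
    -- the auxiliary element
    set k' : SL(2, ℤ) := k * T ^ (-q) * S with hk'
    have hk'10 : k' 1 0 = r := by
      rw [hk', mul_S_apply_10]
      simp [coe_T_zpow, Matrix.mul_apply, Fin.sum_univ_two, ← hcdef, ← hddef]
      linear_combination hrd
    have ih' := ih k' (by rw [hk'10]; exact hr_lt)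
    exact claim_of_mul_T_zpow h (-q) (claim_of_mul_S h (by rw [← hk']; exact ih'))

/-! ### §4 The period law on `Γ₀(15)` -/

/-- **The level-15 period law**: for every `γ = (a b; c d) ∈ Γ₀(15)` and every `h ∈ S₂(Γ₀(15))`,
`{∞, γ∞}_h = n₁E₁(h) + n₂E₂(h)` with `n₁` EVEN iff `d² ≡ 1 (mod 5)` (i.e. `n₁ ≡ [(d/5) = −1]`). [cite: Manin1972, Thm. 1.9] -/
theorem cuspSymbol_decomp (γ : Gamma0 15) :
    ∃ n₁ n₂ : ℤ, cuspSymbol h γ = n₁ * E₁ h + n₂ * E₂ h ∧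
      ((2 : ℤ) ∣ n₁ ↔ ((((γ : SL(2, ℤ)) 1 1 : ℤ) : ZMod 5)) ^ 2 = 1) := by
  obtain ⟨n₁, n₂, hval, hpar⟩ := inftySymbol_decomp h (γ : SL(2, ℤ))
  have hc : (((γ : SL(2, ℤ)) 1 0 : ℤ) : ZMod 15) = ((0 : ℤ) : ZMod 15) := by
    rw [Int.cast_zero]; exact Gamma0_mem.mp γ.2
  rw [hc] at hval hpar
  have h3 := adm_three (γ : SL(2, ℤ)); have h5 := adm_five (γ : SL(2, ℤ))
  rw [hc] at h3 h5
  obtain ⟨hcls, hsgn⟩ := tab_gamma0_int ((γ : SL(2, ℤ)) 1 1) h3 h5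
  obtain ⟨-, -, -, -, hchain⟩ := tab_base
  have hW0 : W h 0 = 0 := by
    unfold W ev; exact Finset.sum_eq_zero fun i _ ↦ by rw [hchain i]; simp
  rw [hcls, hW0, zero_add] at hval
  refine ⟨n₁, n₂, by rw [cuspSymbol_eq_inftySymbol, hval], ?_⟩
  -- `d² ≡ 1 (mod 5)` read on `d.val`
  have hsq : ((((γ : SL(2, ℤ)) 1 1 : ℤ) : ZMod 5)) ^ 2 = 1 ↔
      ((((γ : SL(2, ℤ)) 1 1 : ℤ) : ZMod 15)).val ^ 2 % 5 = 1 := by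
    rw [← val_cast_zmod_five, ← Nat.cast_pow, show (1 : ZMod 5) = ((1 : ℕ) : ZMod 5) by norm_num,
      ZMod.natCast_eq_natCast_iff']
  rw [hsq]
  rcases hsgn with ⟨hs, hq⟩ | ⟨hs, hq⟩
  · rw [hs, sub_zero] at hpar; exact ⟨fun _ ↦ hq, fun _ ↦ hpar⟩
  · rw [hs] at hpar
    constructor
    · intro h2; exfalso; obtain ⟨u, hu⟩ := hpar; obtain ⟨v, hv⟩ := h2; omega
    · intro h1; exact absurd h1 hq

/-- **`{∞, γ₀∞}_h = E₁(h)` for `γ₀ = (8 1; 15 2) ∈ Γ₀(15)`**: the continued fraction `8/15 → 1/2 → 0 → ∞` writes it as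
`[γ₀] + [(1 0; 2 1)] + [S] = x₀ + x₉ + x₁`, which is `e₁` modulo the certified relations. [cite: CremonaAlgorithms1997, §2.3] -/
theorem inftySymbol_gamma0_eq_E₁ :
    inftySymbol h (⟨!![8, 1; 15, 2], by norm_num [Matrix.det_fin_two_of]⟩ : SL(2, ℤ)) = E₁ h := by
  set g : SL(2, ℤ) := (⟨!![8, 1; 15, 2], by norm_num [Matrix.det_fin_two_of]⟩ : SL(2, ℤ)) with hg
  set k₂ : SL(2, ℤ) := (⟨!![1, 0; 2, 1], by norm_num [Matrix.det_fin_two_of]⟩ : SL(2, ℤ)) with hk₂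
  -- step 1: `{∞, g∞} = [g] + {∞, gS∞}`, `gS T^8 = k₂`
  have e1 : inftySymbol h g = msymbolSL h g + inftySymbol h (g * S) := by rw [msymbolSL]; ring
  have e2 : inftySymbol h (g * S) = inftySymbol h k₂ := by
    rw [← inftySymbol_mul_T_zpow h (g * S) 8]
    congr 1; ext i j; fin_cases i <;> fin_cases j <;>
      simp [hg, hk₂, coe_S, coe_T_zpow, Matrix.mul_apply, Fin.sum_univ_two]
  -- step 2: `{∞, k₂∞} = [k₂] + {∞, k₂S∞}`, `k₂ S T² = S`
  have e3 : inftySymbol h k₂ = msymbolSL h k₂ + inftySymbol h (k₂ * S) := by rw [msymbolSL]; ring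
  have e4 : inftySymbol h (k₂ * S) = inftySymbol h S := by
    rw [← inftySymbol_mul_T_zpow h (k₂ * S) 2]
    congr 1; ext i j; fin_cases i <;> fin_cases j <;>
      simp [hk₂, coe_S, coe_T_zpow, Matrix.mul_apply, Fin.sum_univ_two]
  -- step 3: `{∞, S∞} = [S] + {∞, S²∞} = [S]`
  have e5 : inftySymbol h S = msymbolSL h S := by
    rw [msymbolSL, show S * S = -1 from by ext i j; fin_cases i <;> fin_cases j <;>
      simp [coe_S, Matrix.mul_apply, Fin.sum_univ_two], inftySymbol_neg, inftySymbol_one, sub_zero]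
  -- the three M-symbols are `x 0`, `x 9`, `x 1`
  have m1 : msymbolSL h g = xval h 0 := msymbolSL_eq_of_row h (by decide)
  have m2 : msymbolSL h k₂ = xval h 9 := msymbolSL_eq_of_row h (by decide)
  have m3 : msymbolSL h S = xval h 1 :=
    msymbolSL_eq_of_row h (by rw [rep_apply_10, rep_apply_11]; simp [coe_S]; decide)
  -- certificate: `x 0 + x 9 + x 1 = E₁`
  have cert : ∀ i : Fin 24, (((Pi.single 0 (1 : ℤ) : Fin 24 → ℤ) + Pi.single 9 1 + Pi.single 1 1 - e1Tab) : Fin 24 → ℤ) i =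
      relComb gamma0Cert2 gamma0Cert3 i := by decide
  have key : ev (xval h) (((Pi.single 0 (1 : ℤ) : Fin 24 → ℤ) + Pi.single 9 1 + Pi.single 1 1 - e1Tab)) = 0 := by
    rw [ev_congr (xval h) cert]; exact ev_relComb (xval h) (xval_rel2 h) (xval_rel3 h) _ _
  rw [ev_sub, ev_add, ev_add, ev_single, ev_single, ev_single] at key
  rw [e1, e2, e3, e4, e5, m1, m2, m3]
  unfold E₁
  linear_combination key

end Summit.BirchSwinnertonDyer.Rank2.LevelFifteen

end
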